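import Mathlib
import HarnessLib
import HarnessLib.Audit
import Summits.HodgeConjecture.Statement
import Literature.AlgebraicGeometry.HodgeTheory.HodgeModelExistence
import Literature.AlgebraicGeometry.HodgeTheory.GysinFormalism
import Literature.AlgebraicGeometry.Motives.FamiliesVHS
import Literature.AlgebraicGeometry.Motives.BaseChange

/-!
Route: NodalSupport

CLOSED (retired) 2026-08-16T03:08:01Z by planner-rchoice-HodgeConjecture-NodalSupport-b-99568ed1-0 — reason: route-choice (operator hold, bridge-only): retire — conditional_on 'Thomas2005Nodes' is a bib key not a decl; the one crux MiddleDivisorSupport is HC-equivalent (Thomas 2005 Thm 1 + own supports), so the bridge exemption does not apply and  — note: Planner route-choice repair (unit rchoice-HodgeConjecture-NodalSupport-b-99568ed1). Chose (b) retire over (a) 'add Thomas2005Nodes as a crux'. WHY: (1) the named condition is a paper; as a statement it is either Thomas 2005 Thm 1 (a theorem in print — fails the crux test, Literature-fact material), . The file is kept as the record of this route; refuted decls are indexed as negative knowledge (`ledger negatives`).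

CONDITIONAL BRIDGE (D-0019 exemption) on Thomas2005Nodes Thm 1 / the Green–Griffiths singularity
conjecture: the ONE load-bearing statement is (MiddleDivisorSupport) every rational (p,p) class in
the MIDDLE degree 2p of a smooth projective variety of even dimension 2p (p ≥ 1) is supported on a
divisor, i.e. lies in supportedClasses X (2p) 1 = N¹H^{2p}(X(ℂ);ℂ) — sharp printed form: supported
on a NODAL hypersurface section D ∈ |O_X(N)| (PD(α) ∈ im H_{2p}(D;ℚ)), which Thomas2005Nodes Thm 1
proves EQUIVALENT to the Hodge conjecture, and which Green–Griffiths / BrosnanFangNiePearlstein2009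
/ de Cataldo–Migliorini identify with the existence of singularities of the admissible normal
function of α on |O_X(N)|, N ≫ 0 (KerrPearlstein2011 Conj. 41, Thm 42).
Lean (real carriers; Sketch.lean rc 0): MiddleDivisorSupport := ∀ p X, 1 ≤ p → IsSmoothProjective
(2*p) X → ∀ c, IsRationalClass c → IsOfHodgeType (2*p) X (2*p) p p c → c ∈ supportedClasses X (2*p)
1.
Assembly = the folklore reduction chain, each link a typed SUPPORT item (theorems in print): (∀ n X,
nonempty_hodgeModel n X) → DivisorInduction (Deligne Hodge III 8.2.8: classes killed off a divisor D
are Gysin images from a resolution D̃; semisimplicity of polarisable HS; HC one dimension and one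
codimension down) → PencilReduction (2 ≤ 2p < dim X: Lefschetz pencil + relative Hilbert scheme +
weights; Thomas2005Nodes Prop. 2, KerrPearlstein2011 §3.1) → HardLefschetzReduction (2p > dim X;
Voisin I Thm 6.25) → MiddleDivisorSupport → HodgeConjecture, by strong induction on (dimension,
codimension) bottoming out at p = 0 (tree: algebraicClasses_zero).

CONDITIONAL on Thomas2005Nodes — this route is an explicit reduction to that named conjecture (D-0019: crux floor waived).

Rationale: WHY OPEN IT (honestly a reformulation; value = typed infrastructure + attach point). The
Lefschetz/topological line has exactly ONE open statement once the folklore reductions are made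
explicit — every decomposition found in print (Thomas2005Nodes nodal support;
GreenGriffiths2007Singularities / BrosnanFangNiePearlstein2009 singularities of normal functions;
coniveau-1 induction) is EQUIVALENT to HC — so under D-0019 it cannot be a ≥ 2-crux route and is
opened as a conditional bridge naming that statement. What the ledger gains: (1) three real-typed
reduction theorems (DivisorInduction, PencilReduction, HardLefschetzReduction) whose proofs are
classical (Deligne Hodge II/III, Lefschetz pencils, hard Lefschetz) and which, once proved against
the tree's carriers, make "HC ⇔ middle-dimensional divisor support" a LEAN THEOREM about the summit
statement — reusable by every other route (QbarEnvelope and AnchorTransport may then restrict their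
cruxes to middle degree); (2) the decl MiddleDivisorSupport is where the nodal/thimble programme
attaches: card thimble-lattice-nodal-certificates (linked: thimble lattices Λ_D of nodal sections,
fourfold certificates "α ∈ Λ_D ⊗ ℚ + h·H² ⇒ algebraic", over-noded forcing), card
incidence-divisor-node-rigidification, Shimada-type certified Picard–Lefschetz computations on open
Fermat/Delsarte fourfolds (instances `HodgeConjectureFor 4 X`), and Thomas's suggested symplectic
programme (Donaldson pencils; Auroux–Muñoz–Presas: Lagrangian spheres are vanishing cycles ⇒
symplectic nodal hypersurfaces realising a class, then an analytic 'make it holomorphic' step — not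
filed as items: untypable today and the analytic step is where HC hides, Thomas2005Nodes §1, §4).
THE ONE CRUX. #2 MiddleDivisorSupport. Why it might fail: it is equivalent to HC (given the
supports), so only with HC; the informative failure modes are quantitative — the degree N / number
of nodes needed may be astronomically large (Thomas §4: infinitesimally "nearly as difficult as
finding cycles"), and Clemens' converse (HC ⇒ many nodal hypersurfaces) collides with bounds on
nodes/Lagrangian spheres.
KILL CRITERIA. None beyond HC itself for the crux; the route is CLOSED AS SUPERSEDED once the three
supports are proved and MiddleDivisorSupport is shared into another route's assembly, or closed
exhausted if no instance-level certificate (fourfold) lands within tenure.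
NOT DECOMPOSED: nodal vs arbitrary divisor (Thomas: equivalent); primitive vs all classes; the GG
singularity formulation (needs normal functions / admissible VMHS on real carriers —
definition-level gap recorded by the NormalFunctions barrier file).

Novelty: Nearest prior art (READ this session): Thomas2005Nodes = arXiv:math/0212216 =
doi:10.1090/s1056-3911-04-00378-9 (pp.1–4 read: Thm 1 nodal support ⇔ HC; Prop. 2 "presumably
standard" reduction to the middle degree by hard Lefschetz + Lefschetz pencil + relative Hilbert
scheme); KerrPearlstein2011 §3.1, §3.3 (Conj. 41 / Thm 42); GreenGriffiths2007Singularities =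
doi:10.1017/cbo9780511721496.006; BrosnanFangNiePearlstein2009 = doi:10.1007/s00222-009-0191-9;
Shioda1983WhatIsKnown; idea card thimble-lattice-nodal-certificates (new-combination; its items (R)
ConiveauOneSuffices and (T) are this route's supports/crux). Delta: NONE mathematically (known
equivalence; grade known). Organisational delta: the reduction chain is cut into three real-typed
support statements with explicit dimension/codimension bookkeeping (pencil step needs HC for
hyperplane sections in ALL codimensions plus codimension p−1 on the ambient; weights replace Leray
degeneration at the nodal fibres) so that it can be PROVED in the tree, and the single load-bearing
statement is isolated in the weakest typable form (divisor support, N¹) that still closes the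
induction.  [refs: 10.1090/s1056-3911-04-00378-9, 10.1017/cbo9780511721496.006, 10.1007/s00222-009-0191-9, math/0212216, doi:10.1090/s1056-3911-04-00378-9, doi:10.1017/cbo9780511721496.006, doi:10.1007/s00222-009-0191-9, KerrPearlstein2011, BrosnanFangNiePearlstein2009]

Barriers (technique_class: nodal-degeneration, coniveau, lefschetz-pencil): technique_class: nodal-degeneration, coniveau, lefschetz-pencil
- Literature.Barriers.HodgeConjecture.Voisin2003_generalHypersurface_noIntegralClassInF (Griffiths'
normal-function programme: Jacobi inversion fails, J ≠ J_alg): evaded in the SUPPORTS —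
PencilReduction uses the pencil only BELOW the middle degree, where the restriction H^{2p}(X) →
H^{2p}(Y_t) is injective and HC on the hyperplane sections supplies CYCLES directly (relative
Hilbert scheme), never an Abel–Jacobi inversion; in the middle degree the crux asks for support on a
SINGULAR (nodal) member — the Green–Griffiths 'singularities' side that the barrier's evasions_known
names.
- Literature.Barriers.HodgeConjecture.Grothendieck1969_generalHodgeConjecture_false (level-wise
coniveau criterion false): respected — coniveau ≥ 1 is claimed ONLY for Hodge classes (level 0),
where it is equivalent to HC, never Hodge's refuted F^p-criterion; Grothendieck's E³ example (F¹H³)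
is untouched.
- Literature.Barriers.HodgeConjecture.Clemens1983_griffithsGroup_infiniteRank (no finiteness of
cycle groups; 'lefschetz-pencil-induction' à la divisors): respected — the induction is on
(dimension, codimension) through resolutions of supporting divisors and through HC on hyperplane
sections, with ℚ-coefficients and homological equivalence only; no Néron–Severi-type finiteness is
presupposed.
- Literature.Barriers.HodgeConjecture.BlochSrinivas1983_hodgeTypeL0_vanish_of_chowZeroSupported
(decomposition of the diagonal gives coniveau only

Novelty grade: known — ROUTE REVIEW (refuter, 2026-08-15). Novelty KNOWN (planner says so): 'HC ⟺ middle-degree Hodge classes are supported on a (nodal) divisor' is Thomas 2005 Thm 1 with the folklore reductions (hard Lefschetz above the middle, Lefschetz pencil below, divisor induction via Deligne's coniveau description) (refuter refuter-rreview-route-Langlands-LiftDesc-c79f9957-0, 2026-08-15T11:23:00Z; prior: Thomas 2005, Nodes and the Hodge conjecture, J. Algebraic Geom. 14, doi:10.1090/s1056-3911-04-00378-9, Thm 1 and Prop. 2, Green–Griffiths 2007 doi:10.1017/cbo9780511721496.006; Brosnan–Fang–Nie–Pearlstein 2009 doi:10.1007/s00222-009-0191-9, Kerr–Pearlstein 2011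 §3.1, Conj. 41 / Thm 42, Deligne, Théorie de Hodge III §8.2 (coniveau via desingularisations))

History (route lifecycle, newest last):
- 2026-08-16T03:08:01Z · CLOSED retired — route-choice (operator hold, bridge-only): retire — conditional_on 'Thomas2005Nodes' is a bib key not a decl; the one crux MiddleDivisorSupport is HC-equivalent (Thomas 2005 Thm 1 + own supports), so (planner-rchoice-HodgeConjecture-NodalSupport-b-99568ed1-0)

sub-problem: HodgeConjecture · status: closed(retired) · opened planner-plan-HodgeConjecture-0 2026-08-15T10:50:30Z · rev 2 · ledger route-HodgeConjecture-NodalSupport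
GENERATED by the gate from the ledger (D-0016/17). Provers cite these decls: `theorem foo : Summit.HodgeConjecture.HodgeConjecture.Theses.NodalSupport.<Decl> := …` in Summits/HodgeConjecture/HodgeConjecture/Theorems/<Name>.lean.
-/

namespace Summit.HodgeConjecture.HodgeConjecture.Theses.NodalSupport

open scoped BigOperators Topology Manifold Classical MeasureTheory ProbabilityTheory Matrix InnerProductSpace ComplexConjugate ContinuousMap
open Filter Set Function TopologicalSpace MeasureTheory

attribute [summit_statement] _root_.HodgeConjecture

/-- item stmt-HodgeConjecture-1081 · crux · rank 2 · open · by planner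
why it might fail: Equivalent to HC in middle degree (Thomas2005Nodes Thm 1/Prop 2); open for p>=2 (degree>=6 fourfolds in P^5 remain 'candidate counterexamples', arXiv:2105.04695 §2). A supporting nodal D in |O(N)| needs global (0,0)-relations among vanishing cycles, >=2 ODPs, N unbounded (arXiv:0806.1461; Thomas §5)
sources: Thomas2005Nodes, math/0212216, arXiv:0806.1461, KerrPearlstein2011, BrosnanFangNiePearlstein2009, GreenGriffiths2007Singularities
[crux] Every rational (p,p) class in the MIDDLE degree of a smooth projective variety of even
dimension 2p (p ≥ 1) is supported on a divisor: c ∈ supportedClasses X (2p) 1 = N¹H^{2p} (vanishes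
on the complement of some Zariski-closed proper subset). Sharp printed form (Thomas2005Nodes Thm 1,
READ pp.1–4): supported on a NODAL hypersurface section D ∈ |O_X(N)| for some N (PD c ∈ im
H_{2p}(D;ℚ)) — EQUIVALENT to the Hodge conjecture; equivalently the admissible normal function of c
on |O_X(N)|, N ≫ 0, has a singularity (GreenGriffiths2007Singularities;
BrosnanFangNiePearlstein2009; KerrPearlstein2011 Conj. 41/Thm 42). Known for p = 1 (Lefschetz
(1,1)), for X with CH₀ supported in dimension ≤ … (decomposition of the diagonal), cubic fourfolds
(Zucker1977). Attach point for thimble-lattice certificates on fourfolds (card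
thimble-lattice-nodal-certificates) and for Thomas's symplectic suggestion (Donaldson pencils /
Auroux–Muñoz–Presas). -/
@[route_item "route-HodgeConjecture-NodalSupport"]
def MiddleDivisorSupport : Prop :=
  ∀ ⦃p : ℕ⦄ ⦃X : Literature.AlgebraicGeometry.Motives.SchemeOver ℂ⦄, 1 ≤ p → Literature.AlgebraicGeometry.Motives.IsSmoothProjective (2 * p) X → ∀ c : Literature.AlgebraicGeometry.HodgeTheory.complexBetti X (2 * p), Literature.AlgebraicGeometry.HodgeTheory.IsRationalClass c → Literature.AlgebraicGeometry.HodgeTheory.IsOfHodgeType (2 * p) X (2 * p) p p c → c ∈ Literature.AlgebraicGeometry.HodgeTheory.supportedClasses X (2 * p) 1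

/-- item stmt-HodgeConjecture-1082 · support · rank 9 · closed · proved by Summit.HodgeConjecture.HodgeConjecture.Theorems.nodalSupport_divisorInduction_proof @ 3fc7f6c6a7c9 (prover) · by planner
sources: DeligneHodgeIII1974, VoisinHodgeII2003, Thomas2005Nodes
[support] Divisor induction (theorem in print): if HC holds in codimension p−1 for smooth projective
n-folds, then on a smooth projective (n+1)-fold every rational (p,p) class supported on a divisor is
algebraic. Proof: enlarge the support to a divisor D; ker(H^{2p}(X) → H^{2p}(X∖D)) = Gysin image of
H^{2p−2}(D̃)(−1) for a resolution D̃ → D (Deligne, Hodge III Cor. 8.2.8); the Gysin map is a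
morphism of polarisable Hodge structures, so by semisimplicity a Hodge class in the image lifts to a
Hodge class on D̃ (componentwise, D̃ = ⊔ D̃_j smooth projective of dim n); HC(D̃_j, p−1) and
'push-forward of algebraic is algebraic' conclude. Needs Hironaka + cycle class/Gysin on the tree's
carriers. -/
@[route_item "route-HodgeConjecture-NodalSupport"]
def DivisorInduction : Prop :=
  ∀ (n p : ℕ), 1 ≤ p → (∀ ⦃Y : Literature.AlgebraicGeometry.Motives.SchemeOver ℂ⦄, Literature.AlgebraicGeometry.Motives.IsSmoothProjective n Y → ∀ c : Literature.AlgebraicGeometry.HodgeTheory.complexBetti Y (2 * (p - 1)), Literature.AlgebraicGeometry.HodgeTheory.IsRationalClass c → Literature.AlgebraicGeometry.HodgeTheory.IsOfHodgeType n Y (2 * (p - 1)) (p - 1) (p - 1) c → c ∈ Literature.AlgebraicGeometry.HodgeTheory.algebraicClasses Y (p - 1)) → ∀ ⦃X : Literature.AlgebraicGeometry.Motives.SchemeOver ℂ⦄, Literature.AlgebraicGeometry.Motives.IsSmoothProjective (n + 1) X → ∀ c : Literature.AlgebraicGeometry.HodgeTheory.complexBetti X (2 * p), Literature.AlgebraicGeometry.HodgeTheory.IsRationalClass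 c → Literature.AlgebraicGeometry.HodgeTheory.IsOfHodgeType (n + 1) X (2 * p) p p c → c ∈ Literature.AlgebraicGeometry.HodgeTheory.supportedClasses X (2 * p) 1 → c ∈ Literature.AlgebraicGeometry.HodgeTheory.algebraicClasses X p

/-- item stmt-HodgeConjecture-1083 · support · rank 9 · closed · proved by Summit.HodgeConjecture.HodgeConjecture.Theorems.linearSystemTorelli_pencilReduction_proof @ df9bbf4b207d (prover) · by planner
sources: Thomas2005Nodes, arXiv:2105.04695, KerrPearlstein2011, DeligneHodgeII1971, VoisinHodgeII2003
[support] Lefschetz-pencil reduction below the middle (theorem in print, Thomas2005Nodes Prop. 2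
'presumably standard'; KerrPearlstein2011 §3.1; Shioda1983WhatIsKnown): for 2 ≤ 2p ≤ m and X smooth
projective of dimension m+1, HC in ALL codimensions for smooth projective m-folds (the hyperplane
sections) plus HC in codimension p−1 for (m+1)-folds imply HC in codimension p for X. Proof:
Lefschetz pencil 𝒳̃ = Bl_B X → ℙ¹; H^{2p}(X) ↪ H^{2p}(Y_t) (weak Lefschetz); HC on each smooth Y_t
gives cycles, the relative Hilbert scheme + countability give an algebraic family of cycles over a
finite cover of ℙ¹ (Thomas/Schoen argument); d·π^*c − [𝒵̄] vanishes on smooth fibres hence (weights: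
W_{2p} of the smooth part; H²(U) = 0 for U affine) is supported on the singular fibres, a divisor,
so DivisorInduction-type Gysin + HC(p−1) finish; π_* returns to X. -/
@[route_item "route-HodgeConjecture-NodalSupport"]
def PencilReduction : Prop :=
  ∀ (m p : ℕ), 1 ≤ p → 2 * p ≤ m → (∀ ⦃Y : Literature.AlgebraicGeometry.Motives.SchemeOver ℂ⦄, Literature.AlgebraicGeometry.Motives.IsSmoothProjective m Y → ∀ (q : ℕ) (c : Literature.AlgebraicGeometry.HodgeTheory.complexBetti Y (2 * q)), Literature.AlgebraicGeometry.HodgeTheory.IsRationalClass c → Literature.AlgebraicGeometry.HodgeTheory.IsOfHodgeType m Y (2 * q) q q c → c ∈ Literature.AlgebraicGeometry.HodgeTheory.algebraicClasses Y q) → (∀ ⦃X' : Literature.AlgebraicGeometry.Motives.SchemeOver ℂ⦄, Literature.AlgebraicGeometry.Motives.IsSmoothProjective (m + 1) X' → ∀ c : Literature.AlgebraicGeometry.HodgeTheory.complexBetti X' (2 * (p - 1)), Literature.AlgebraicGeometry.HodgeTheory.IsRationalClass c → Literature.AlgebraicGeometry.HodgeTheory.IsOfHodgeType (m + 1) X'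 (2 * (p - 1)) (p - 1) (p - 1) c → c ∈ Literature.AlgebraicGeometry.HodgeTheory.algebraicClasses X' (p - 1)) → ∀ ⦃X : Literature.AlgebraicGeometry.Motives.SchemeOver ℂ⦄, Literature.AlgebraicGeometry.Motives.IsSmoothProjective (m + 1) X → ∀ c : Literature.AlgebraicGeometry.HodgeTheory.complexBetti X (2 * p), Literature.AlgebraicGeometry.HodgeTheory.IsRationalClass c → Literature.AlgebraicGeometry.HodgeTheory.IsOfHodgeType (m + 1) X (2 * p) p p c → c ∈ Literature.AlgebraicGeometry.HodgeTheory.algebraicClasses X p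

/-- item stmt-HodgeConjecture-1084 · support · rank 9 · closed · proved by Summit.HodgeConjecture.HodgeConjecture.Theorems.linearSystemTorelli_hardLefschetzReduction_proof @ fc8b66396040 (prover) · by planner
sources: VoisinHodgeI2002, Thomas2005Nodes, Shioda1983WhatIsKnown
[support] Hard-Lefschetz reduction above the middle (theorem in print): for n < 2p on a smooth
projective n-fold, HC in codimension n−p implies HC in codimension p — L^{2p−n} : H^{2n−2p} → H^{2p}
is an isomorphism of Hodge structures (VoisinHodgeI2002 Thm 6.25) so a rational (p,p) class is
L^{2p−n} of a rational (n−p,n−p) class, and cup product with powers of the hyperplane class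
preserves algebraicity (move the hyperplanes; cf.
HardLefschetzThreefold.lefschetzOperator_mem_algebraicClasses). For p > n both sides are trivial
(H^{2p} = 0 above real dimension; truncated n − p = 0 and algebraicClasses X 0 = ⊤). -/
@[route_item "route-HodgeConjecture-NodalSupport"]
def HardLefschetzReduction : Prop :=
  ∀ (n p : ℕ), n < 2 * p → ∀ ⦃X : Literature.AlgebraicGeometry.Motives.SchemeOver ℂ⦄, Literature.AlgebraicGeometry.Motives.IsSmoothProjective n X → (∀ c : Literature.AlgebraicGeometry.HodgeTheory.complexBetti X (2 * (n - p)), Literature.AlgebraicGeometry.HodgeTheory.IsRationalClass c → Literature.AlgebraicGeometry.HodgeTheory.IsOfHodgeType n X (2 * (n - p)) (n - p) (n - p) c → c ∈ Literature.AlgebraicGeometry.HodgeTheory.algebraicClasses X (n - p)) → ∀ c : Literature.AlgebraicGeometry.HodgeTheory.complexBetti X (2 * p), Literature.AlgebraicGeometry.HodgeTheory.IsRationalClass c → Literature.AlgebraicGeometry.HodgeTheory.IsOfHodgeType n X (2 * p) p p c → c ∈ Literature.AlgebraicGeometry.HodgeTheory.algebraicClasses X p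

/-- item stmt-HodgeConjecture-1943 · support · rank 9 · closed · proved by Summit.HodgeConjecture.HodgeConjecture.Theorems.nodalSupport_hodgeModels_proof @ 6468568b8792 (prover) · by planner
sources: SerreGAGA1956, WarnerGTM94, VoisinHodgeI2002
[support] needs-fact: Literature.AlgebraicGeometry.HodgeTheory.nonempty_hodgeModel (route-repair,
cone guardrail 2026-08-15). GENUINELY needed: `Nonempty (HodgeModel n X)` is conjunct 1 of
HodgeTheory.HodgeConjectureFor, i.e. part of the summit statement itself, so every route to
HodgeConjecture must produce it. This decl is VERBATIM the first antecedent of this route's Assembly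
(and of NodalSupport's and QbarEnvelope's — re-ask this exact signature there to share the item); it
is filed as an item so that the closing chain is items-only (`Assembly_holds HodgeModels_holds
IsoInvariance_holds VariationalHodge_holds AnchorExistence_holds : HodgeConjecture` typechecks with
no unfolding; planner Sketch.lean rc 0, where `HodgeModels ↔ ∀ n X, IsSmoothProjective n X →
Nonempty (HodgeModel n X)` is Iff.rfl) and so that the fact is named in the ledger as tier-0 debt of
the summit. HOW IT CLOSES: one line, `fun n X => nonempty_hodgeModel_holds`, once the Literature
fact is discharged — the reduction is already in tree:
HodgeModelExistenceDischarge.nonempty_hodgeModel_of_deRham_of_hodgeDecomposition (remaining leaves: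
the real de Rham theorem exists_deRhamIsoFamily and the Hodge decomposition -/
@[route_item "route-HodgeConjecture-NodalSupport"]
def HodgeModels : Prop :=
  ∀ (n : ℕ) (X : Literature.AlgebraicGeometry.Motives.SchemeOver ℂ), Literature.AlgebraicGeometry.HodgeTheory.nonempty_hodgeModel n X

/-- item stmt-HodgeConjecture-1085 · assembly · rank 1 · closed · proved by Summit.HodgeConjecture.HodgeConjecture.Theorems.linearSystemTorelli_assembly_proof @ 04283636fb30 (prover) · by planner
[assembly] Strong induction on the dimension, inner induction on the codimension p: p = 0 by
algebraicClasses_zero (tree); 0 < 2p < dim: PencilReduction with the outer hypothesis (all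
codimensions one dimension down) and the inner hypothesis (p−1); 2p = dim: MiddleDivisorSupport then
DivisorInduction (outer hypothesis in codimension p−1); 2p > dim: HardLefschetzReduction (inner
hypothesis at n−p < p); the HodgeModel conjunct is the antecedent fact. Pure logic + Nat arithmetic;
provable now. -/
@[route_item "route-HodgeConjecture-NodalSupport"]
def Assembly : Prop :=
  (∀ (n : ℕ) (X : Literature.AlgebraicGeometry.Motives.SchemeOver ℂ), Literature.AlgebraicGeometry.HodgeTheory.nonempty_hodgeModel n X) → DivisorInduction → PencilReduction → HardLefschetzReduction → MiddleDivisorSupport → _root_.HodgeConjecture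

end Summit.HodgeConjecture.HodgeConjecture.Theses.NodalSupport
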